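import Mathlib.MeasureTheory.Measure.Haar.InnerProductSpace
import Summits.AtomisticToContinuum.HydrodynamicLimit.Theorems.CollisionIsometryCLTMacroClosureTlChart
import Summits.AtomisticToContinuum.HydrodynamicLimit.Theorems.CollisionIsometryCLTMacroClosureTlSuper
import Summits.AtomisticToContinuum.HydrodynamicLimit.Theorems.CollisionIsometryCLTMacroClosureTlMono
import Summits.AtomisticToContinuum.HydrodynamicLimit.Theorems.CollisionIsometryCLTMacroClosureTlApriori
import Summits.AtomisticToContinuum.HydrodynamicLimit.Theorems.CollisionIsometryCLTMacroClosureTlChain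
import Summits.AtomisticToContinuum.HydrodynamicLimit.Theorems.CollisionIsometryCLTMacroClosureRuelleEstimate
import HarnessLib

/-!
# The thermodynamic limit of the hard-sphere free volume, part A: Ruelle's box free energy

Support file (`--supports stmt-AtomisticToContinuum-14870`) of the lead of the line `IdeatorTwoGen1Sketch`
for the crux `MacroClosure`; first half of the thermodynamic-limit step of the stub `stub_blockMGF`
(the block large-deviation object of the line needs `lim_N −N⁻¹ log hsFreeVolume η N` to EXIST; the tree
only defines `hsExcessFreeEnergy η` as the `limsup`).

Ruelle's INNER-CUBE BOX FREE VOLUME at `m` particles and density `η` is the Lebesgue volume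

`B(m, η) := Leb {w : Fin m → ℝ³ | |w i l| ≤ (1 − t)/2, pairwise t ≤ ‖w i − w j‖}`, `t := (η/m)^{1/3}`

(exclusion distance `t`, particles kept `t/2` away from the boundary of the unit cube), and its rate is
`b(m, η) := −m⁻¹ log B(m, η)`. From the wave-4 stubs of the line we derive the four structural properties
consumed by the abstract chain lemma `tl_chain`: boundedness `0 ≤ b ≤ C` (`tl_apriori`, `tl_mono`),
monotonicity in the density (`tl_mono`), particle removal `n b(n, ηn/n') ≤ n' b(n', η)` (`tl_mono`), and
the near-subadditivity `b(k³m, η) ≤ b(m, η) + (1 + ½ log m)/m` along the chains `m ↦ k³m` at FIXED density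
(`tl_super` + `tl_chart` + Stirling) — whence (`ThermoLimitA.chain`) for `0 ≤ η' < η ≤ 23/20`:

`limsup_m b(m, η') ≤ liminf_m b(m, η)`.

To keep statements short the lemmas take the function `B` together with its defining equation as a
hypothesis (`hB`); nothing is assumed about it otherwise.

Reference: D. Ruelle, *Statistical Mechanics: Rigorous Results* (1969), §3.4, Thm 3.4.4.
-/

noncomputable section

open MeasureTheory Filter Set Topology
open scoped ENNReal

namespace Summit.AtomisticToContinuum.HydrodynamicLimit.Theorems.MacroClosureLine

open Literature.MathematicalPhysics.KineticTheory Literature.Analysis.FluidPDE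
open Literature.Analysis.FunctionSpaces

namespace Barycentric

namespace ThermoLimitA

/-! ### The exclusion parameter `t = (η/m)^{1/3}` -/

/-- `0 < t < 1` and `t ≤ 1` bookkeeping for `t = (η/m)^{1/3}`, `0 < η ≤ 23/20`, `m ≥ 2`. -/
theorem t_props {m : ℕ} (hm : 2 ≤ m) {η : ℝ} (hη : 0 < η) (hη' : η ≤ 23 / 20) :
    0 < (η / m) ^ (1 / 3 : ℝ) ∧ (η / m) ^ (1 / 3 : ℝ) < 1 := by
  have hm0 : (0 : ℝ) < m := by exact_mod_cast (lt_of_lt_of_le (by norm_num) hm)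
  have hm2 : (2 : ℝ) ≤ m := by exact_mod_cast hm
  refine ⟨Real.rpow_pos_of_pos (div_pos hη hm0) _, ?_⟩
  have hlt : η / m < 1 := by rw [div_lt_one hm0]; linarith
  exact Real.rpow_lt_one (div_pos hη hm0).le hlt (by norm_num)

/-- `0 ≤ t ≤ 1` for `0 ≤ η ≤ 23/20`, `m ≥ 2`. -/
theorem t_props' {m : ℕ} (hm : 2 ≤ m) {η : ℝ} (hη : 0 ≤ η) (hη' : η ≤ 23 / 20) :
    0 ≤ (η / m) ^ (1 / 3 : ℝ) ∧ (η / m) ^ (1 / 3 : ℝ) ≤ 1 := by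
  have hm0 : (0 : ℝ) < m := by exact_mod_cast (lt_of_lt_of_le (by norm_num) hm)
  have hm2 : (2 : ℝ) ≤ m := by exact_mod_cast hm
  refine ⟨Real.rpow_nonneg (div_nonneg hη hm0.le) _, ?_⟩
  have hle : η / m ≤ 1 := by rw [div_le_one hm0]; linarith
  exact Real.rpow_le_one (div_nonneg hη hm0.le) hle (by norm_num)

/-- The exclusion parameter is monotone in the density. -/
theorem t_mono {m : ℕ} {η η' : ℝ} (hη : 0 ≤ η) (h : η ≤ η') :
    (η / m) ^ (1 / 3 : ℝ) ≤ (η' / m) ^ (1 / 3 : ℝ) :=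
  Real.rpow_le_rpow (div_nonneg hη (Nat.cast_nonneg m))
    (div_le_div_of_nonneg_right h (Nat.cast_nonneg m)) (by norm_num)

/-! ### The box free volume: `B ≤ 1`, monotonicity, `B > 0` -/

/-- The unit cube of `ℝ³` (as `EuclideanSpace`) has Lebesgue measure `1`. -/
theorem volume_cube_eq_one :
    volume {v : V3 | ∀ l, |v l| ≤ 1 / 2} = 1 := by
  have h : {v : V3 | ∀ l, |v l| ≤ 1 / 2} =
      WithLp.ofLp ⁻¹' Set.Icc (fun _ : Fin 3 => -(1 / 2 : ℝ)) (fun _ => 1 / 2) := by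
    ext v
    simp only [Set.mem_setOf_eq, Set.mem_preimage, Set.mem_Icc, Pi.le_def, abs_le]
    exact ⟨fun h => ⟨fun l => (h l).1, fun l => (h l).2⟩, fun h l => ⟨h.1 l, h.2 l⟩⟩
  rw [h, (PiLp.volume_preserving_ofLp (Fin 3)).measure_preimage
    measurableSet_Icc.nullMeasurableSet, Real.volume_Icc_pi]
  norm_num

/-- At density `0` the box free volume is `1` (the constraint set is the full unit cube). -/
theorem box_zero (m : ℕ) :
    (volume {w : Fin m → V3 | (∀ i l, |w i l| ≤ (1 - ((0 : ℝ) / m) ^ (1 / 3 : ℝ)) / 2) ∧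
      ∀ i j, i ≠ j → ((0 : ℝ) / m) ^ (1 / 3 : ℝ) ≤ ‖w i - w j‖}).toReal = 1 := by
  have h0 : ((0 : ℝ) / m) ^ (1 / 3 : ℝ) = 0 := by
    rw [zero_div, Real.zero_rpow (by norm_num)]
  simp_rw [h0]
  have hset : {w : Fin m → V3 | (∀ i l, |w i l| ≤ (1 - 0) / 2) ∧ ∀ i j, i ≠ j → (0 : ℝ) ≤ ‖w i - w j‖} =
      Set.pi Set.univ fun _ : Fin m => {v : V3 | ∀ l, |v l| ≤ 1 / 2} := by
    ext w
    simp only [sub_zero, Set.mem_setOf_eq, Set.mem_pi, Set.mem_univ, true_implies]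
    exact ⟨fun h i l => h.1 i l, fun h => ⟨fun i l => h i l, fun i j _ => norm_nonneg _⟩⟩
  rw [hset]
  have hvol : (volume : Measure (Fin m → V3)) = Measure.pi fun _ => volume := rfl
  rw [hvol, Measure.pi_pi, Finset.prod_const, volume_cube_eq_one, one_pow, ENNReal.toReal_one]

section BoxFunction

variable {B : ℕ → ℝ → ℝ}
  (hB : ∀ (m : ℕ) (η : ℝ), B m η = (volume {w : Fin m → V3 |
    (∀ i l, |w i l| ≤ (1 - (η / m) ^ (1 / 3 : ℝ)) / 2) ∧
      ∀ i j, i ≠ j → (η / m) ^ (1 / 3 : ℝ) ≤ ‖w i - w j‖}).toReal)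

include hB

/-- `B(m, η) ≤ 1` for `m ≥ 2`, `0 ≤ η ≤ 23/20`. -/
theorem box_le_one {m : ℕ} (hm : 2 ≤ m) {η : ℝ} (hη : 0 ≤ η) (hη' : η ≤ 23 / 20) : B m η ≤ 1 := by
  obtain ⟨ht0, ht1⟩ := t_props' hm hη hη'
  rw [hB]
  have h := tl_mono.2.2 m (1 - (η / m) ^ (1 / 3 : ℝ)) ((η / m) ^ (1 / 3 : ℝ)) (by linarith) (by linarith)
  have := ENNReal.toReal_mono ENNReal.one_ne_top h
  simpa using this

omit hB in
/-- The volume of the box constraint set is finite. -/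
theorem box_ne_top (m : ℕ) {η : ℝ} (hm : 2 ≤ m) (hη : 0 ≤ η) (hη' : η ≤ 23 / 20) :
    volume {w : Fin m → V3 | (∀ i l, |w i l| ≤ (1 - (η / m) ^ (1 / 3 : ℝ)) / 2) ∧
      ∀ i j, i ≠ j → (η / m) ^ (1 / 3 : ℝ) ≤ ‖w i - w j‖} ≠ ⊤ := by
  obtain ⟨ht0, ht1⟩ := t_props' hm hη hη'
  have h := tl_mono.2.2 m (1 - (η / m) ^ (1 / 3 : ℝ)) ((η / m) ^ (1 / 3 : ℝ)) (by linarith) (by linarith)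
  exact ne_top_of_le_ne_top ENNReal.one_ne_top h

/-- Monotonicity in the density: `η ≤ η'` gives `B(m, η') ≤ B(m, η)` (`m ≥ 2`, densities in `[0, 23/20]`). -/
theorem box_anti {m : ℕ} (hm : 2 ≤ m) {η η' : ℝ} (hη : 0 ≤ η) (h : η ≤ η') (hη' : η' ≤ 23 / 20) :
    B m η' ≤ B m η := by
  obtain ⟨_, ht1'⟩ := t_props' hm (hη.trans h) hη'
  have htt := t_mono (m := m) hη h
  rw [hB, hB]
  refine ENNReal.toReal_mono (box_ne_top m hm hη (h.trans hη')) ?_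
  exact tl_mono.1 m (1 - (η / m) ^ (1 / 3 : ℝ)) (1 - (η' / m) ^ (1 / 3 : ℝ)) ((η / m) ^ (1 / 3 : ℝ))
    ((η' / m) ^ (1 / 3 : ℝ)) (by linarith) (by linarith) htt

/-- **Positivity with an exponential lower bound** (from `tl_apriori` and monotonicity): there are `C ≥ 0`
and `M ≥ 2` with `exp(−Cm) ≤ B(m, η)` for all `m ≥ M` and all `η ∈ [0, 23/20]`. -/
theorem box_exp_le : ∃ C : ℝ, 0 ≤ C ∧ ∃ M : ℕ, 2 ≤ M ∧ ∀ m : ℕ, M ≤ m → ∀ η : ℝ, 0 ≤ η → η ≤ 23 / 20 →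
    Real.exp (-(C * m)) ≤ B m η := by
  obtain ⟨C, m₀, h⟩ := tl_apriori
  refine ⟨max C 0, le_max_right _ _, max m₀ 2, le_max_right _ _, fun m hm η hη hη' => ?_⟩
  have hm₀ : m₀ ≤ m := le_trans (le_max_left _ _) hm
  have hm2 : 2 ≤ m := le_trans (le_max_right _ _) hm
  have h1 : Real.exp (-(max C 0 * m)) ≤ Real.exp (-(C * m)) := by
    refine Real.exp_le_exp.2 ?_
    have : C * m ≤ max C 0 * m := mul_le_mul_of_nonneg_right (le_max_left _ _) (Nat.cast_nonneg m)
    linarith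
  have h2 : Real.exp (-(C * m)) ≤ B m (23 / 20) := by rw [hB]; exact h m hm₀ (23 / 20) (by norm_num) le_rfl
  exact h1.trans (h2.trans (box_anti hB hm2 hη hη' le_rfl))

/-! ### The rate `b(m, η) = −m⁻¹ log B(m, η)` -/

/-- (P0) `0 ≤ b ≤ C` and (P4) monotonicity of the rate in the density, for `m ≥ M`. -/
theorem rate_props : ∃ C : ℝ, 0 ≤ C ∧ ∃ M : ℕ, 2 ≤ M ∧
    (∀ m : ℕ, M ≤ m → ∀ η : ℝ, 0 ≤ η → η ≤ 23 / 20 →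
      0 < B m η ∧ 0 ≤ -(m : ℝ)⁻¹ * Real.log (B m η) ∧ -(m : ℝ)⁻¹ * Real.log (B m η) ≤ C) ∧
    (∀ m : ℕ, M ≤ m → ∀ η η' : ℝ, 0 ≤ η → η ≤ η' → η' ≤ 23 / 20 →
      -(m : ℝ)⁻¹ * Real.log (B m η) ≤ -(m : ℝ)⁻¹ * Real.log (B m η')) := by
  obtain ⟨C, hC, M, hM, h⟩ := box_exp_le hB
  refine ⟨C, hC, M, hM, fun m hm η hη hη' => ?_, fun m hm η η' hη hle hη' => ?_⟩
  · have hm2 : 2 ≤ m := hM.trans hm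
    have hm0 : (0 : ℝ) < m := by exact_mod_cast (lt_of_lt_of_le (by norm_num) hm2)
    have hexp := h m hm η hη hη'
    have hpos : 0 < B m η := (Real.exp_pos _).trans_le hexp
    have hle1 := box_le_one hB hm2 hη hη'
    have hlog0 : Real.log (B m η) ≤ 0 := Real.log_nonpos hpos.le hle1
    have hlogC : -(C * m) ≤ Real.log (B m η) := by
      rw [← Real.log_exp (-(C * m))]; exact Real.log_le_log (Real.exp_pos _) hexp
    refine ⟨hpos, ?_, ?_⟩
    · have : -(m : ℝ)⁻¹ ≤ 0 := by simp [hm0.le]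
      exact mul_nonneg_of_nonpos_of_nonpos this hlog0
    · calc -(m : ℝ)⁻¹ * Real.log (B m η) = (m : ℝ)⁻¹ * (-Real.log (B m η)) := by ring
        _ ≤ (m : ℝ)⁻¹ * (C * m) := mul_le_mul_of_nonneg_left (by linarith) (inv_nonneg.2 hm0.le)
        _ = C := by field_simp
  · have hm2 : 2 ≤ m := hM.trans hm
    have hm0 : (0 : ℝ) < m := by exact_mod_cast (lt_of_lt_of_le (by norm_num) hm2)
    have hpos' : 0 < B m η' := (Real.exp_pos _).trans_le (h m hm η' (hη.trans hle) hη')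
    have hanti := box_anti hB hm2 hη hle hη'
    have hlog := Real.log_le_log hpos' hanti
    have : -(m : ℝ)⁻¹ ≤ 0 := by simp [hm0.le]
    exact mul_le_mul_of_nonpos_left hlog this

/-- (P2) **Particle removal**: `n b(n, ηn/n') ≤ n' b(n', η)` for `M ≤ n ≤ n'`. -/
theorem rate_removal {M : ℕ} (hM : 2 ≤ M)
    (hpos : ∀ m : ℕ, M ≤ m → ∀ η : ℝ, 0 ≤ η → η ≤ 23 / 20 → 0 < B m η)
    {n n' : ℕ} (hn : M ≤ n) (hnn' : n ≤ n') {η : ℝ} (hη : 0 ≤ η) (hη' : η ≤ 23 / 20) :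
    (n : ℝ) * (-(n : ℝ)⁻¹ * Real.log (B n (η * n / n'))) ≤ n' * (-(n' : ℝ)⁻¹ * Real.log (B n' η)) := by
  have hn2 : 2 ≤ n := hM.trans hn
  have hn'2 : 2 ≤ n' := hn2.trans hnn'
  have hn0 : (0 : ℝ) < n := by exact_mod_cast (lt_of_lt_of_le (by norm_num) hn2)
  have hn'0 : (0 : ℝ) < n' := by exact_mod_cast (lt_of_lt_of_le (by norm_num) hn'2)
  -- the two exclusion parameters agree
  have ht : (η * n / n' / n) ^ (1 / 3 : ℝ) = (η / n') ^ (1 / 3 : ℝ) := by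
    congr 1; field_simp
  obtain ⟨ht0, ht1⟩ := t_props' hn'2 hη hη'
  have hsub := tl_mono.2.1 n n' (1 - (η / n') ^ (1 / 3 : ℝ)) ((η / n') ^ (1 / 3 : ℝ)) hnn'
    (by linarith) (by linarith)
  have hset : {w : Fin n → V3 | (∀ i l, |w i l| ≤ (1 - (η * n / n' / n) ^ (1 / 3 : ℝ)) / 2) ∧
      ∀ i j, i ≠ j → (η * n / n' / n) ^ (1 / 3 : ℝ) ≤ ‖w i - w j‖} =
      {w : Fin n → V3 | (∀ i l, |w i l| ≤ (1 - (η / n') ^ (1 / 3 : ℝ)) / 2) ∧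
        ∀ i j, i ≠ j → (η / n') ^ (1 / 3 : ℝ) ≤ ‖w i - w j‖} := by
    ext w; simp only [Set.mem_setOf_eq, ht]
  have hfin : volume {w : Fin n → V3 | (∀ i l, |w i l| ≤ (1 - (η / n') ^ (1 / 3 : ℝ)) / 2) ∧
      ∀ i j, i ≠ j → (η / n') ^ (1 / 3 : ℝ) ≤ ‖w i - w j‖} ≠ ⊤ :=
    ne_top_of_le_ne_top ENNReal.one_ne_top
      (tl_mono.2.2 n (1 - (η / n') ^ (1 / 3 : ℝ)) ((η / n') ^ (1 / 3 : ℝ)) (by linarith) (by linarith))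
  have hBle : B n' η ≤ B n (η * n / n') := by
    rw [hB, hB, hset]
    exact ENNReal.toReal_mono hfin hsub
  have hposn' : 0 < B n' η := hpos n' (hn.trans hnn') η hη hη'
  have hlog := Real.log_le_log hposn' hBle
  have e1 : (n : ℝ) * (-(n : ℝ)⁻¹ * Real.log (B n (η * n / n'))) = -Real.log (B n (η * n / n')) := by
    field_simp
  have e2 : (n' : ℝ) * (-(n' : ℝ)⁻¹ * Real.log (B n' η)) = -Real.log (B n' η) := by field_simp
  rw [e1, e2]
  linarith

/-- (P1) **Near-subadditivity along the chains `m ↦ k³m` at fixed density**: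
`b(k³m, η) ≤ b(m, η) + (1 + ½ log m)/m` (`tl_super` + `tl_chart` + Stirling). -/
theorem rate_chain {M : ℕ} (hM : 2 ≤ M)
    (hpos : ∀ m : ℕ, M ≤ m → ∀ η : ℝ, 0 ≤ η → η ≤ 23 / 20 → 0 < B m η)
    {k m : ℕ} (hk : 1 ≤ k) (hm : M ≤ m) {η : ℝ} (hη : 0 ≤ η) (hη' : η ≤ 23 / 20) :
    -((k ^ 3 * m : ℕ) : ℝ)⁻¹ * Real.log (B (k ^ 3 * m) η) ≤
      -(m : ℝ)⁻¹ * Real.log (B m η) + (1 + Real.log m / 2) / m := by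
  have hm2 : 2 ≤ m := hM.trans hm
  have hm0 : (0 : ℝ) < m := by exact_mod_cast (lt_of_lt_of_le (by norm_num) hm2)
  have hdef : 0 ≤ (1 + Real.log m / 2) / m := by
    have : 0 ≤ Real.log m := Real.log_nonneg (by linarith [(show (2 : ℝ) ≤ m by exact_mod_cast hm2)])
    positivity
  -- k = 1: trivial
  rcases eq_or_lt_of_le hk with hk1 | hk1
  · subst hk1
    simp only [one_pow, one_mul]
    linarith
  have hk2 : 2 ≤ k := hk1
  have hk0 : (0 : ℝ) < k := by exact_mod_cast (lt_of_lt_of_le (by norm_num) hk2)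
  -- η = 0: B(N, 0) = 1
  rcases hη.eq_or_lt with h0 | hηpos
  · subst h0
    have hB0 : B (k ^ 3 * m) 0 = 1 := by rw [hB]; exact box_zero _
    have hBm : B m 0 = 1 := by rw [hB]; exact box_zero _
    rw [hB0, hBm, Real.log_one, mul_zero, mul_zero, zero_add]
    exact hdef
  -- η > 0, k ≥ 2: the super-multiplicativity
  set t : ℝ := (η / m) ^ (1 / 3 : ℝ) with ht
  obtain ⟨ht0, ht1⟩ := t_props hm2 hηpos hη'
  obtain ⟨N, hNdef⟩ : ∃ N : ℕ, N = k ^ 3 * m := ⟨_, rfl⟩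
  have hN : M ≤ N := hNdef ▸ le_trans hm (Nat.le_mul_of_pos_left m (pow_pos (by omega) 3))
  have hNr : (N : ℝ) = (k : ℝ) ^ 3 * m := by rw [hNdef]; push_cast; ring
  have hN0 : (0 : ℝ) < N := by rw [hNr]; positivity
  have hsuper := tl_super k m t hk2 ht0 ht1
  rw [← hNdef] at hsuper
  -- the right-hand side of `tl_super` is `B(N, η)` by `tl_chart`
  have htk : (η / (N : ℝ)) ^ (1 / 3 : ℝ) = t / k := by
    rw [ht, hNr]
    have hk3 : ((k : ℝ) ^ 3) ^ (1 / 3 : ℝ) = k := by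
      rw [← Real.rpow_natCast, ← Real.rpow_mul hk0.le]; norm_num
    rw [show η / ((k : ℝ) ^ 3 * m) = (η / m) / (k : ℝ) ^ 3 by field_simp,
      Real.div_rpow (div_nonneg hη hm0.le) (by positivity), hk3]
  have htk1 : t / k < 1 := by
    rw [div_lt_one hk0]
    have : (2 : ℝ) ≤ k := by exact_mod_cast hk2
    linarith
  have hchart := tl_chart N (fun _ => (((((k : ℝ) - 1) / (2 * k) : ℝ)) : UnitAddCircle)) (1 - t / k) (t / k)
    (by linarith) (div_pos ht0 hk0) (by linarith)
  have hBN : B N η = (volume {q : Fin N → T3 |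
      (∀ i l, |Torus.reprSym (q i - fun _ => (((((k : ℝ) - 1) / (2 * k) : ℝ)) : UnitAddCircle)) l| ≤
        (1 - t / k) / 2) ∧ ∀ i j, i ≠ j → t / k ≤ Torus.euclidDist (q i) (q j)}).toReal := by
    have hset : {w : Fin N → V3 | (∀ i l, |w i l| ≤ (1 - (η / N) ^ (1 / 3 : ℝ)) / 2) ∧
        ∀ i j, i ≠ j → (η / N) ^ (1 / 3 : ℝ) ≤ ‖w i - w j‖} =
        {w : Fin N → V3 | (∀ i l, |w i l| ≤ (1 - t / k) / 2) ∧ ∀ i j, i ≠ j → t / k ≤ ‖w i - w j‖} := by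
      ext w; simp only [Set.mem_setOf_eq, htk]
    rw [hB, hset, hchart]
  have hBm : B m η = (volume {w : Fin m → V3 | (∀ i l, |w i l| ≤ (1 - t) / 2) ∧
      ∀ i j, i ≠ j → t ≤ ‖w i - w j‖}).toReal := by rw [hB]
  rw [← hBN, ← hBm] at hsuper
  -- positivity
  have hBmpos : 0 < B m η := hpos m hm η hη hη'
  have hBNpos : 0 < B N η := hpos N hN η hη hη'
  have hfac : ∀ n : ℕ, (0 : ℝ) < n.factorial := fun n => by exact_mod_cast n.factorial_pos
  -- logarithms
  have hlog := Real.log_le_log (by positivity) hsuper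
  rw [Real.log_mul (by positivity) (by positivity), Real.log_div (by positivity) (by positivity),
    Real.log_div (hfac N).ne' (by positivity), Real.log_pow, Real.log_pow, Real.log_pow] at hlog
  -- Stirling
  have hNne : N ≠ 0 := by rw [hNdef]; positivity
  have hmne : m ≠ 0 := by omega
  have e0 := RuelleEstimate.log_factorial_ge hNne
  have e1 := RuelleEstimate.log_factorial_le hmne
  have hlogN : Real.log N = 3 * Real.log k + Real.log m := by
    rw [hNr, Real.log_mul (by positivity) hm0.ne', Real.log_pow]; push_cast; ring
  have hk3r : (0 : ℝ) ≤ (k : ℝ) ^ 3 := by positivity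
  have m1 := mul_le_mul_of_nonneg_left e1 hk3r
  have m1' : (k : ℝ) ^ 3 * Real.log m.factorial ≤
      N * Real.log m - N + (k : ℝ) ^ 3 * (1 + Real.log m / 2) := by
    have e : (k : ℝ) ^ 3 * (m * Real.log m - m + 1 + Real.log m / 2) =
        (k : ℝ) ^ 3 * m * Real.log m - (k : ℝ) ^ 3 * m + (k : ℝ) ^ 3 * (1 + Real.log m / 2) := by ring
    rw [e, ← hNr] at m1
    exact m1
  have q : (N : ℝ) * Real.log N = 3 * (N * Real.log k) + N * Real.log m := by rw [hlogN]; ring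
  -- assemble: −log B(N) ≤ k³ (1 + log m / 2) − k³ log B(m)
  have h3 : ((3 * N : ℕ) : ℝ) * Real.log k = 3 * (N * Real.log k) := by push_cast; ring
  have hk3c : ((k ^ 3 : ℕ) : ℝ) = (k : ℝ) ^ 3 := by push_cast; ring
  rw [hk3c] at hlog
  have key : -Real.log (B N η) ≤ (k : ℝ) ^ 3 * (1 + Real.log m / 2) - (k : ℝ) ^ 3 * Real.log (B m η) := by
    have hlog' : Real.log N.factorial - (k : ℝ) ^ 3 * Real.log m.factorial - 3 * (N * Real.log k) +
        (k : ℝ) ^ 3 * Real.log (B m η) ≤ Real.log (B N η) := by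
      have := hlog
      rw [h3] at this
      exact this
    linarith [hlog', e0, m1', q]
  -- divide by N
  have hinvN : 0 < (N : ℝ)⁻¹ := inv_pos.2 hN0
  rw [← hNdef]
  calc -(N : ℝ)⁻¹ * Real.log (B N η)
      = (N : ℝ)⁻¹ * (-Real.log (B N η)) := by ring
    _ ≤ (N : ℝ)⁻¹ * ((k : ℝ) ^ 3 * (1 + Real.log m / 2) - (k : ℝ) ^ 3 * Real.log (B m η)) :=
        mul_le_mul_of_nonneg_left key hinvN.le
    _ = -(m : ℝ)⁻¹ * Real.log (B m η) + (1 + Real.log m / 2) / m := by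
        rw [hNr]; field_simp; ring

/-- **The chain conclusion** (abstract lemma `tl_chain` fed with (P0)–(P4)): for `0 ≤ η' < η ≤ 23/20`,
`limsup_m b(m, η') ≤ liminf_m b(m, η)`. [cite: Ruelle1969, §3.4] -/
theorem chain {η η' : ℝ} (hη' : 0 ≤ η') (hlt : η' < η) (hη : η ≤ 23 / 20) :
    limsup (fun m : ℕ => -(m : ℝ)⁻¹ * Real.log (B m η')) atTop ≤
      liminf (fun m : ℕ => -(m : ℝ)⁻¹ * Real.log (B m η)) atTop := by
  obtain ⟨C, _, M, hM, hP0, hP4⟩ := rate_props hB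
  have hpos : ∀ m : ℕ, M ≤ m → ∀ η : ℝ, 0 ≤ η → η ≤ 23 / 20 → 0 < B m η :=
    fun m hm η h0 h1 => (hP0 m hm η h0 h1).1
  have h := tl_chain (fun m η => -(m : ℝ)⁻¹ * Real.log (B m η)) C (23 / 20) M (by omega) (by norm_num)
    (fun m hm η h0 h1 => ⟨(hP0 m hm η h0 h1).2.1, (hP0 m hm η h0 h1).2.2⟩)
    (fun m hm η η' h0 hle h1 => hP4 m hm η η' h0 hle h1)
    (fun k m hk hm η h0 h1 => rate_chain hB hM hpos hk hm h0 h1)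
    (fun n n' hn hnn' η h0 h1 => rate_removal hB hM hpos hn hnn' h0 h1)
    η η' hη' hlt hη
  exact h

end BoxFunction

end ThermoLimitA

/-- **Registered helper sub-goal `thermo_box_chain`** (thermodynamic-limit step of `stub_blockMGF`, part A, in
closed form): for Ruelle's inner-cube box free volume `B(m, η)` and `0 ≤ η' < η ≤ 23/20`,
`limsup_m (−m⁻¹ log B(m, η')) ≤ liminf_m (−m⁻¹ log B(m, η))`. [cite: Ruelle1969, §3.4] -/
theorem thermo_box_chain : ∀ (η η' : ℝ), 0 ≤ η' → η' < η → η ≤ 23 / 20 → limsup (fun m : ℕ => -(m : ℝ)⁻¹ * Real.log ((volume {w : Fin m → V3 | (∀ i l, |w i l| ≤ (1 - (η' / m) ^ (1 / 3 : ℝ)) / 2) ∧ ∀ i j, i ≠ j → (η' / m) ^ (1 / 3 : ℝ) ≤ ‖w i - w j‖}).toReal)) atTop ≤ liminf (fun m : ℕ => -(m : ℝ)⁻¹ * Real.log ((volume {w : Fin m → V3 | (∀ i l, |w i l| ≤ (1 - (η / m) ^ (1 / 3 : ℝ)) / 2) ∧ ∀ i j, i ≠ j → (η / m) ^ (1 /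 3 : ℝ) ≤ ‖w i - w j‖}).toReal)) atTop :=
  fun _ _ h₁ h₂ h₃ => ThermoLimitA.chain (B := fun m η => (volume {w : Fin m → V3 |
    (∀ i l, |w i l| ≤ (1 - (η / m) ^ (1 / 3 : ℝ)) / 2) ∧
      ∀ i j, i ≠ j → (η / m) ^ (1 / 3 : ℝ) ≤ ‖w i - w j‖}).toReal) (fun _ _ => rfl) h₁ h₂ h₃

end Barycentric

end Summit.AtomisticToContinuum.HydrodynamicLimit.Theorems.MacroClosureLine

end
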